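import Summits.HubbardSuperconductivity.HubbardSuperconductivity.Theorems.JosephsonMirrorFreeLayersDecoupling
import Summits.HubbardSuperconductivity.HubbardSuperconductivity.Theorems.JosephsonMirrorPairBridgeGivesGain
import Summits.HubbardSuperconductivity.HubbardSuperconductivity.Theorems.JosephsonMirrorFeynmanHellmann
import HarnessLib

/-!
# Route `JosephsonMirror` — crux `JmCusp`, line `Sketch`: the Kronecker AM–GM converse

Support file for the crux stmt-HubbardSuperconductivity-2228 (`JmCusp`) of route `JosephsonMirror`
(sub-problem `HubbardSuperconductivity`): stub `stub_amgm_converse` of the line skeleton `Sketch`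
(`JosephsonGain ⇒ TwoSectorCusp`, unfolded verbatim). The uniform linear Josephson gain of the
window double `H_L(J) = A ⊗ 1 + 1 ⊗ Aᵀ - J (D ⊗ D̄ + Dᴴ ⊗ D̄ᴴ)` (`A = H - μ_L N`, `D = L⁻¹ P`,
`P = Δ_d`, `D̄ = (Dᴴ)ᵀ`) on the mirror window never exceeds the better window sector's sum of the
two orderings' single-layer deformation gains:
`E_L(0) - E_L(J) ≤ max_{N' ∈ {N_L, N_L - 2}} [(e(N') - e_{PPᴴ}(N')) + (e(N') - e_{PᴴP}(N'))]`
(`e(N') = minEnergyOn H (N', S^z = 0)`, `e_Q(N') = minEnergyOn (H - (J/L²) Q) (N', 0)`).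
Steps: `E(0) ≤ 2a` (`a = e(N_L) - μ_L N_L = e(N_L - 2) - μ_L (N_L - 2)`, balancing `μ_L`) by the
trial state `φ ⊗ φ̄`; the Kronecker AM–GM ceiling `D ⊗ D̄ + Dᴴ ⊗ D̄ᴴ ≤ DDᴴ ⊗ 1 + 1 ⊗ (DᴴD)ᵀ`
(`re_coupling_le` of Theorems/JosephsonMirrorFreeLayersDecoupling); BLOCK-DEPENDENT floors
(`min_blockFloor_le_minEnergyOn`, sharpening the uniform-floor `minEnergyOn_sub_le_of_floors`):
columns / rows of a window vector live in one block and the entry `(s, t)` carries the weight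
`x_b + y_b` of its own block `b`. Sources: the AM–GM operator inequality of Bogoliubov's
approximating-Hamiltonian method, J.-B. Bru, W. de Siqueira Pedra, Rev. Math. Phys. 22 (2010) 233;
T. Koma, H. Tasaki, J. Stat. Phys. 76 (1994) 745 (variational two-sided bounds); E. H. Lieb,
Phys. Rev. Lett. 62 (1989) 1201 (`W`-matrix packaging, `S^z = 0` sector). No new definitions.
-/

-- the mandated namespace `Summit.<Summit>.<Problem>.Theorems` repeats `HubbardSuperconductivity`
-- (single-problem summit, D-0017), which the `dupNamespace` linter flags on every declaration
set_option linter.dupNamespace false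

namespace Summit.HubbardSuperconductivity.HubbardSuperconductivity.Theorems.JosephsonMirror

open Matrix Literature.MathematicalPhysics.QuantumLattice
open scoped Kronecker ComplexOrder
section Abstract

variable {ι : Type*} [Fintype ι] [DecidableEq ι]

/-- **Block-dependent floors bound the window double from below.** Let the window `S` consist of
the two-layer vectors supported on pairs in a common block (`P₁` or `P₂`, disjoint), and let
`A - J DDᴴ ≥ x_b`, `A - J DᴴD ≥ y_b` on the vectors supported in block `b`. Then for `J ≥ 0`,
`min_b (x_b + y_b) ≤ E(J)`: by the Kronecker AM–GM ceiling (`re_coupling_le`), `Re ⟨ψ, H(J) ψ⟩` is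
at least the sum of the column quotients of `A - J DDᴴ` and the conjugate-row quotients of
`A - J DᴴD`; columns (rows) of a window vector live in one block, and the entry `(s, t)` collects
the weight `x_b + y_b` of its own block. Bru–de Siqueira Pedra, Rev. Math. Phys. 22 (2010) 233;
Koma–Tasaki, J. Stat. Phys. 76 (1994) 745; Lieb, PRL 62 (1989) 1201. [folklore] -/
theorem min_blockFloor_le_minEnergyOn (A D : Matrix ι ι ℂ)
    (P₁ P₂ : ι → Prop) (h12 : ∀ s, P₁ s → ¬ P₂ s)
    (good : ι × ι → Prop) (hgood : ∀ s t, good (s, t) → (P₁ s ∧ P₁ t) ∨ (P₂ s ∧ P₂ t))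
    (S : Submodule ℂ (ι × ι → ℂ)) (hS : ∀ ψ, ψ ∈ S ↔ ∀ p, ¬ good p → ψ p = 0)
    (hne : ∃ ψ ∈ S, star ψ ⬝ᵥ ψ = 1) {J : ℝ} (hJ : 0 ≤ J) (x₁ y₁ x₂ y₂ : ℝ)
    (hx₁ : ∀ v : ι → ℂ, (∀ s, ¬ P₁ s → v s = 0) →
      x₁ * (star v ⬝ᵥ v).re ≤ (star v ⬝ᵥ (A - (J : ℂ) • (D * Dᴴ)) *ᵥ v).re)
    (hx₂ : ∀ v : ι → ℂ, (∀ s, ¬ P₂ s → v s = 0) →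
      x₂ * (star v ⬝ᵥ v).re ≤ (star v ⬝ᵥ (A - (J : ℂ) • (D * Dᴴ)) *ᵥ v).re)
    (hy₁ : ∀ v : ι → ℂ, (∀ s, ¬ P₁ s → v s = 0) →
      y₁ * (star v ⬝ᵥ v).re ≤ (star v ⬝ᵥ (A - (J : ℂ) • (Dᴴ * D)) *ᵥ v).re)
    (hy₂ : ∀ v : ι → ℂ, (∀ s, ¬ P₂ s → v s = 0) →
      y₂ * (star v ⬝ᵥ v).re ≤ (star v ⬝ᵥ (A - (J : ℂ) • (Dᴴ * D)) *ᵥ v).re) :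
    (x₁ + y₁) ⊓ (x₂ + y₂) ≤
      (A ⊗ₖ (1 : Matrix ι ι ℂ) + (1 : Matrix ι ι ℂ) ⊗ₖ Aᵀ -
        (J : ℂ) • (D ⊗ₖ Dᴴᵀ + Dᴴ ⊗ₖ Dᵀ)).minEnergyOn S := by
  classical
  obtain ⟨ψ₀, hψ₀S, hψ₀1⟩ := hne
  refine le_csInf ⟨_, ψ₀, hψ₀S, hψ₀1, rfl⟩ ?_
  rintro E ⟨ψ, hψS, hψ1, rfl⟩
  set m : ℝ := (x₁ + y₁) ⊓ (x₂ + y₂)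
  have hz : ∀ s t, ¬ good (s, t) → ψ (s, t) = 0 := fun s t hst => (hS ψ).1 hψS (s, t) hst
  have hre : ∀ v : ι → ℂ, (star v ⬝ᵥ v).re = ∑ i, ‖v i‖ ^ 2 := fun v => by
    rw [dotProduct, Complex.re_sum]
    refine Finset.sum_congr rfl fun i _ => ?_
    rw [Pi.star_apply, Complex.star_def, Complex.conj_mul', ← Complex.ofReal_pow, Complex.ofReal_re]
  -- (1) block floors, column- and row-wise, with block-dependent constants
  let ω : ι → ℝ := fun t => if P₂ t then x₂ else x₁
  let ω' : ι → ℝ := fun s => if P₂ s then y₂ else y₁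
  have hcol : ∀ t, ω t * (star (fun s => ψ (s, t)) ⬝ᵥ (fun s => ψ (s, t))).re ≤
      (star (fun s => ψ (s, t)) ⬝ᵥ (A - (J : ℂ) • (D * Dᴴ)) *ᵥ (fun s => ψ (s, t))).re := by
    intro t
    by_cases h2 : P₂ t
    · simp only [ω, if_pos h2]
      refine hx₂ _ fun s hs => hz s t fun hg => ?_
      rcases hgood s t hg with ⟨-, ht'⟩ | ⟨hs', -⟩
      · exact h12 t ht' h2
      · exact hs hs'
    · simp only [ω, if_neg h2]
      refine hx₁ _ fun s hs => hz s t fun hg => ?_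
      rcases hgood s t hg with ⟨hs', -⟩ | ⟨-, ht'⟩
      · exact hs hs'
      · exact h2 ht'
  have hrow : ∀ s, ω' s * (star (fun t => ψ (s, t)) ⬝ᵥ (fun t => ψ (s, t))).re ≤
      (star (star fun t => ψ (s, t)) ⬝ᵥ (A - (J : ℂ) • (Dᴴ * D)) *ᵥ (star fun t => ψ (s, t))).re := by
    intro s
    rw [← star_star_dotProduct_star_self]
    have hz' : ∀ t, ¬ good (s, t) → (star fun t => ψ (s, t)) t = 0 := fun t ht => by
      simp [hz s t ht]
    by_cases h2 : P₂ s
    · simp only [ω', if_pos h2]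
      refine hy₂ _ fun t ht => hz' t fun hg => ?_
      rcases hgood s t hg with ⟨hs', -⟩ | ⟨-, ht'⟩
      · exact h12 s hs' h2
      · exact ht ht'
    · simp only [ω', if_neg h2]
      refine hy₁ _ fun t ht => hz' t fun hg => ?_
      rcases hgood s t hg with ⟨-, ht'⟩ | ⟨hs', -⟩
      · exact ht ht'
      · exact h2 hs'
  -- (2) pointwise: the entry `(s, t)` carries the weight `x_b + y_b ≥ m` of its own block `b`
  have hpt : ∀ s t, m * ‖ψ (s, t)‖ ^ 2 ≤ (ω t + ω' s) * ‖ψ (s, t)‖ ^ 2 := by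
    intro s t
    by_cases h0 : ψ (s, t) = 0
    · simp [h0]
    · have hg : good (s, t) := by
        by_contra hg
        exact h0 (hz s t hg)
      refine mul_le_mul_of_nonneg_right ?_ (by positivity)
      rcases hgood s t hg with ⟨hs, ht⟩ | ⟨hs, ht⟩
      · simp only [ω, ω', if_neg (h12 t ht), if_neg (h12 s hs)]
        exact inf_le_left
      · simp only [ω, ω', if_pos ht, if_pos hs]
        exact inf_le_right
  have hsum : m ≤ ∑ t, ω t * (star (fun s => ψ (s, t)) ⬝ᵥ (fun s => ψ (s, t))).re +
      ∑ s, ω' s * (star (fun t => ψ (s, t)) ⬝ᵥ (fun t => ψ (s, t))).re := by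
    have h1 : (star ψ ⬝ᵥ ψ).re = 1 := by rw [hψ1, Complex.one_re]
    rw [star_dotProduct_self_eq_sum_rows, Complex.re_sum] at h1
    simp only [hre, Finset.mul_sum] at h1 ⊢
    calc m = ∑ s, ∑ t, m * ‖ψ (s, t)‖ ^ 2 := by simp only [← Finset.mul_sum, h1, mul_one]
      _ ≤ ∑ s, ∑ t, (ω t + ω' s) * ‖ψ (s, t)‖ ^ 2 :=
          Finset.sum_le_sum fun s _ => Finset.sum_le_sum fun t _ => hpt s t
      _ = ∑ t, ∑ s, ω t * ‖ψ (s, t)‖ ^ 2 + ∑ s, ∑ t, ω' s * ‖ψ (s, t)‖ ^ 2 := by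
          simp only [add_mul, Finset.sum_add_distrib]
          congr 1
          exact Finset.sum_comm
  -- (3) the column / row sums are the Rayleigh quotients of `X ⊗ 1`, `1 ⊗ Yᵀ`; AM–GM ceiling
  have hcolsum : ∑ t, (star (fun s => ψ (s, t)) ⬝ᵥ (A - (J : ℂ) • (D * Dᴴ)) *ᵥ
        (fun s => ψ (s, t))).re =
      (star ψ ⬝ᵥ (A ⊗ₖ (1 : Matrix ι ι ℂ)) *ᵥ ψ).re -
        J * (star ψ ⬝ᵥ ((D * Dᴴ) ⊗ₖ (1 : Matrix ι ι ℂ)) *ᵥ ψ).re := by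
    rw [star_dotProduct_kronecker_one_mulVec, star_dotProduct_kronecker_one_mulVec,
      Complex.re_sum, Complex.re_sum, Finset.mul_sum, ← Finset.sum_sub_distrib]
    refine Finset.sum_congr rfl fun t _ => ?_
    rw [sub_mulVec, smul_mulVec, dotProduct_sub, dotProduct_smul, smul_eq_mul, Complex.sub_re,
      Complex.re_ofReal_mul]
  have hrowsum : ∑ s, (star (star fun t => ψ (s, t)) ⬝ᵥ (A - (J : ℂ) • (Dᴴ * D)) *ᵥ
        (star fun t => ψ (s, t))).re =
      (star ψ ⬝ᵥ ((1 : Matrix ι ι ℂ) ⊗ₖ Aᵀ) *ᵥ ψ).re -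
        J * (star ψ ⬝ᵥ ((1 : Matrix ι ι ℂ) ⊗ₖ (Dᴴ * D)ᵀ) *ᵥ ψ).re := by
    rw [star_dotProduct_one_kronecker_mulVec, star_dotProduct_one_kronecker_mulVec,
      Complex.re_sum, Complex.re_sum, Finset.mul_sum, ← Finset.sum_sub_distrib]
    refine Finset.sum_congr rfl fun s _ => ?_
    rw [star_dotProduct_transpose_mulVec, star_dotProduct_transpose_mulVec, sub_mulVec,
      smul_mulVec, dotProduct_sub, dotProduct_smul, smul_eq_mul, Complex.sub_re,
      Complex.re_ofReal_mul]
  have hK := mul_le_mul_of_nonneg_left (re_coupling_le D ψ) hJ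
  calc m ≤ _ := hsum
    _ ≤ ∑ t, (star (fun s => ψ (s, t)) ⬝ᵥ (A - (J : ℂ) • (D * Dᴴ)) *ᵥ (fun s => ψ (s, t))).re +
          ∑ s, (star (star fun t => ψ (s, t)) ⬝ᵥ (A - (J : ℂ) • (Dᴴ * D)) *ᵥ
            (star fun t => ψ (s, t))).re :=
        add_le_add (Finset.sum_le_sum fun t _ => hcol t) (Finset.sum_le_sum fun s _ => hrow s)
    _ ≤ _ := by
        rw [hcolsum, hrowsum, re_rayleigh_windowDouble, add_mulVec, dotProduct_add, Complex.add_re]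
        linarith

/-- **Abstract AM–GM converse** `E(0) - E(J) ≤ max_b (2a - x_b - y_b)` for the window double
`H(J) = A ⊗ 1 + 1 ⊗ Aᵀ - J (D ⊗ D̄ + Dᴴ ⊗ D̄ᴴ)` on the window of pairs in a common block, given
floors `A - J DDᴴ ≥ x_b`, `A - J DᴴD ≥ y_b` on block `b`, a unit `A`-eigenvector `φ` (eigenvalue
`a`) supported in `P₁`, and `J ≥ 0` (`E(0) ≤ 2a` by the trial state `φ ⊗ φ̄`; `E(J) ≥ min_b` by
`min_blockFloor_le_minEnergyOn`); the block-dependent sharpening of `minEnergyOn_sub_le_of_floors`.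
Bru–de Siqueira Pedra, Rev. Math. Phys. 22 (2010) 233; Koma–Tasaki, J. Stat. Phys. 76 (1994) 745.
[folklore] -/
theorem minEnergyOn_sub_le_max_blockGain (A D : Matrix ι ι ℂ) (hA : A.IsHermitian)
    (P₁ P₂ : ι → Prop) (h12 : ∀ s, P₁ s → ¬ P₂ s)
    (good : ι × ι → Prop) (hgood : ∀ s t, good (s, t) → (P₁ s ∧ P₁ t) ∨ (P₂ s ∧ P₂ t))
    (hgood₁ : ∀ s t, P₁ s → P₁ t → good (s, t))
    (S : Submodule ℂ (ι × ι → ℂ)) (hS : ∀ ψ, ψ ∈ S ↔ ∀ p, ¬ good p → ψ p = 0)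
    (a : ℝ) (φ : ι → ℂ) (hφP : ∀ s, ¬ P₁ s → φ s = 0) (hφ1 : star φ ⬝ᵥ φ = 1)
    (hAφ : A *ᵥ φ = (a : ℂ) • φ) {J : ℝ} (hJ : 0 ≤ J) (x₁ y₁ x₂ y₂ : ℝ)
    (hx₁ : ∀ v : ι → ℂ, (∀ s, ¬ P₁ s → v s = 0) →
      x₁ * (star v ⬝ᵥ v).re ≤ (star v ⬝ᵥ (A - (J : ℂ) • (D * Dᴴ)) *ᵥ v).re)
    (hx₂ : ∀ v : ι → ℂ, (∀ s, ¬ P₂ s → v s = 0) →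
      x₂ * (star v ⬝ᵥ v).re ≤ (star v ⬝ᵥ (A - (J : ℂ) • (D * Dᴴ)) *ᵥ v).re)
    (hy₁ : ∀ v : ι → ℂ, (∀ s, ¬ P₁ s → v s = 0) →
      y₁ * (star v ⬝ᵥ v).re ≤ (star v ⬝ᵥ (A - (J : ℂ) • (Dᴴ * D)) *ᵥ v).re)
    (hy₂ : ∀ v : ι → ℂ, (∀ s, ¬ P₂ s → v s = 0) →
      y₂ * (star v ⬝ᵥ v).re ≤ (star v ⬝ᵥ (A - (J : ℂ) • (Dᴴ * D)) *ᵥ v).re) :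
    (A ⊗ₖ (1 : Matrix ι ι ℂ) + (1 : Matrix ι ι ℂ) ⊗ₖ Aᵀ -
          ((0 : ℝ) : ℂ) • (D ⊗ₖ Dᴴᵀ + Dᴴ ⊗ₖ Dᵀ)).minEnergyOn S -
        (A ⊗ₖ (1 : Matrix ι ι ℂ) + (1 : Matrix ι ι ℂ) ⊗ₖ Aᵀ -
          (J : ℂ) • (D ⊗ₖ Dᴴᵀ + Dᴴ ⊗ₖ Dᵀ)).minEnergyOn S ≤
      (2 * a - x₁ - y₁) ⊔ (2 * a - x₂ - y₂) := by
  -- the trial vector `φ ⊗ φ̄`: a unit window vector with `(A ⊗ 1 + 1 ⊗ Aᵀ)(φ ⊗ φ̄) = 2a (φ ⊗ φ̄)`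
  set v : ι × ι → ℂ := fun p : ι × ι => φ p.1 * (star φ) p.2 with hv
  have hvv : star v ⬝ᵥ v = 1 := by
    rw [hv, star_tensor_conj_dotProduct, hφ1]
    simp
  have hvS : v ∈ S := by
    refine (hS v).2 fun p hp => ?_
    obtain ⟨s, t⟩ := p
    show φ s * (star φ) t = 0
    by_cases hs : P₁ s
    · by_cases ht : P₁ t
      · exact absurd (hgood₁ s t hs ht) hp
      · rw [Pi.star_apply, hφP t ht, star_zero, mul_zero]
    · rw [hφP s hs, zero_mul]
  have hH₀v : (A ⊗ₖ (1 : Matrix ι ι ℂ) + (1 : Matrix ι ι ℂ) ⊗ₖ Aᵀ) *ᵥ v = ((2 * a : ℝ) : ℂ) • v := by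
    rw [hv, double_mulVec_tensor_conj hA hAφ]
  have h0 : (A ⊗ₖ (1 : Matrix ι ι ℂ) + (1 : Matrix ι ι ℂ) ⊗ₖ Aᵀ -
      ((0 : ℝ) : ℂ) • (D ⊗ₖ Dᴴᵀ + Dᴴ ⊗ₖ Dᵀ)).minEnergyOn S ≤ 2 * a := by
    refine (minEnergyOn_windowDouble_le hA D 0 S hvS hvv).trans (le_of_eq ?_)
    rw [zero_mul, sub_zero, hH₀v, dotProduct_smul, hvv, smul_eq_mul, mul_one, Complex.ofReal_re]
  have hJ' := min_blockFloor_le_minEnergyOn A D P₁ P₂ h12 good hgood S hS ⟨v, hvS, hvv⟩ hJ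
    x₁ y₁ x₂ y₂ hx₁ hx₂ hy₁ hy₂
  rcases le_total (x₁ + y₁) (x₂ + y₂) with h | h
  · rw [inf_eq_left.2 h] at hJ'
    exact le_sup_of_le_left (by linarith)
  · rw [inf_eq_right.2 h] at hJ'
    exact le_sup_of_le_right (by linarith)

end Abstract

section Torus

/-- **The AM–GM converse on the torus** (every even `L ≥ 2`, `δ ∈ (0, 1/2)`, `J ≥ 0`): the
Josephson gain `E_L(0) - E_L(J)` of the window double on `A = H - μ_L N`, `D = L⁻¹ Δ_d` is at most
the better window sector's `G(N') (P Pᴴ) + G(N') (Pᴴ P)`, `N' ∈ {N_L, N_L - 2}`,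
`G(N') Q = e(N') - minEnergyOn (H - (J/L²) Q) (N', 0)`: `minEnergyOn_sub_le_max_blockGain` with the
blocks `(N_L, 0)`, `(N_L - 2, 0)`, the common eigenvalue `a = e(N_L) - μ_L N_L = e(N_L-2) - μ_L (N_L-2)`
of a sector ground state, and the sector-variational floors of `A - J DDᴴ = (H - (J/L²) PPᴴ) - μ_L N`.
Bru–de Siqueira Pedra, Rev. Math. Phys. 22 (2010) 233; Koma–Tasaki, J. Stat. Phys. 76 (1994) 745.
[folklore] -/
theorem josephsonGain_le_twoSectorGain (L : ℕ) [NeZero L] (U δ J : ℝ) (hE : Even L)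
    (hδ : δ ∈ Set.Ioo (0:ℝ) (1 / 2)) (hJ : 0 ≤ J) :
    let ι : Type := Finset (Orb (FermionTorus 2 L))
    let N : ℕ := 2 * ⌊(1 - δ) * (L : ℝ) ^ 2 / 2⌋₊
    let H : Matrix ι ι ℂ := hubbardTorus 2 L 1 U
    let μ : ℝ := (H.minEnergyOn (szSector N 0) - H.minEnergyOn (szSector (N - 2) 0)) / 2
    let A : Matrix ι ι ℂ := hubbardTorusWith 2 L 1 U μ
    let D : Matrix ι ι ℂ := ((L : ℂ))⁻¹ • pairField dWaveFormFactor L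
    let Hd : ℝ → Matrix (ι × ι) (ι × ι) ℂ := fun J =>
      A ⊗ₖ (1 : Matrix ι ι ℂ) + (1 : Matrix ι ι ℂ) ⊗ₖ Aᵀ - (J : ℂ) • (D ⊗ₖ Dᴴᵀ + Dᴴ ⊗ₖ Dᵀ)
    let good : ι × ι → Prop := fun p =>
      ((p.1.card = N ∧ p.2.card = N) ∨ (p.1.card = N - 2 ∧ p.2.card = N - 2)) ∧
        (p.1.filter (fun o => (ofLex o).2 = 0)).card =
            (p.1.filter (fun o => (ofLex o).2 = 1)).card ∧
          (p.2.filter (fun o => (ofLex o).2 = 0)).card =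
            (p.2.filter (fun o => (ofLex o).2 = 1)).card
    let S : Submodule ℂ (ι × ι → ℂ) :=
      ⨅ (p : ι × ι) (_ : ¬ good p),
        LinearMap.ker (LinearMap.proj (R := ℂ) (φ := fun _ : ι × ι => ℂ) p)
    let E : ℝ → ℝ := fun J => (Hd J).minEnergyOn S
    let P : Matrix ι ι ℂ := pairField dWaveFormFactor L
    let c : ℂ := ((J / (L : ℝ) ^ 2 : ℝ) : ℂ)
    let G : ℕ → Matrix ι ι ℂ → ℝ := fun n Q =>
      H.minEnergyOn (szSector n 0) - (H - c • Q).minEnergyOn (szSector n 0)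
    E 0 - E J ≤ (G N (P * Pᴴ) + G N (Pᴴ * P)) ⊔ (G (N - 2) (P * Pᴴ) + G (N - 2) (Pᴴ * P)) := by
  intro ι N H μ A D Hd good S E P c G
  -- the filling: `N = 2n` with `1 ≤ n ≤ L²` (as in `jmPairBridgeGivesGain_proof`)
  set n : ℕ := ⌊(1 - δ) * (L : ℝ) ^ 2 / 2⌋₊ with hn
  have hNn : N = 2 * n := rfl
  have hL2 : (2 : ℝ) ≤ L := by
    obtain ⟨k, hk⟩ := hE
    exact_mod_cast (show 2 ≤ L by have h0 : L ≠ 0 := NeZero.ne L; omega)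
  have hn1 : 1 ≤ n := by
    refine hn ▸ Nat.le_floor ?_
    rw [Nat.cast_one, le_div_iff₀ (by norm_num : (0 : ℝ) < 2)]
    nlinarith [hδ.2, hL2]
  have hnL : n ≤ L ^ 2 := by
    refine hn ▸ Nat.floor_le_of_le ?_
    have hL0 : (0 : ℝ) ≤ (L : ℝ) ^ 2 := by positivity
    push_cast
    nlinarith [hδ.1]
  have hN2 : N - 2 = 2 * (n - 1) := by omega
  have hN2' : ((N - 2 : ℕ) : ℝ) = (N : ℝ) - 2 := by rw [Nat.cast_sub (by omega)]; norm_num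
  -- energies and the balancing chemical potential
  set e₁ : ℝ := H.minEnergyOn (szSector N 0)
  set e₂ : ℝ := H.minEnergyOn (szSector (N - 2) 0)
  set a : ℝ := e₁ - μ * N with ha
  have ha₂ : a = e₂ - μ * ((N - 2 : ℕ) : ℝ) := by rw [hN2', ha, show μ = (e₁ - e₂) / 2 from rfl]; ring
  have hAherm : A.IsHermitian := isHermitian_hamiltonianWith _ 1 U μ
  have hHherm : H.IsHermitian := LiebThm1.hamiltonian_isHermitian (fermionTorusGraph 2 L) 1 U
  set F : ι → Prop := fun s =>
    (s.filter fun o => (ofLex o).2 = 0).card = (s.filter fun o => (ofLex o).2 = 1).card with hF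
  set P₁ : ι → Prop := fun s => s.card = N ∧ F s with hP₁
  set P₂ : ι → Prop := fun s => s.card = N - 2 ∧ F s with hP₂
  have h12 : ∀ s, P₁ s → ¬ P₂ s := by rintro s ⟨h1, -⟩ ⟨h2, -⟩; omega
  have hgood : ∀ s t, good (s, t) → (P₁ s ∧ P₁ t) ∨ (P₂ s ∧ P₂ t) := by
    rintro s t ⟨h | h, hs, ht⟩
    exacts [Or.inl ⟨⟨h.1, hs⟩, ⟨h.2, ht⟩⟩, Or.inr ⟨⟨h.1, hs⟩, ⟨h.2, ht⟩⟩]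
  have hgood₁ : ∀ s t, P₁ s → P₁ t → good (s, t) := fun s t hs ht =>
    ⟨Or.inl ⟨hs.1, ht.1⟩, hs.2, ht.2⟩
  have hS : ∀ ψ, ψ ∈ S ↔ ∀ p, ¬ good p → ψ p = 0 := fun ψ => by
    simp only [S, Submodule.mem_iInf, LinearMap.mem_ker, LinearMap.proj_apply]
  -- `J · D Dᴴ = c · P Pᴴ` and `J · Dᴴ D = c · Pᴴ P` (`D = L⁻¹ P`, `c = J / L²`)
  have hLs : star ((L : ℂ)⁻¹) = (L : ℂ)⁻¹ := by
    rw [Complex.star_def, map_inv₀, Complex.conj_natCast]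
  have hcJ : (J : ℂ) * (L : ℂ)⁻¹ * (L : ℂ)⁻¹ = c := by
    show (J : ℂ) * (L : ℂ)⁻¹ * (L : ℂ)⁻¹ = ((J / (L : ℝ) ^ 2 : ℝ) : ℂ)
    push_cast; ring
  have hDD : (J : ℂ) • (D * Dᴴ) = c • (P * Pᴴ) := by
    show (J : ℂ) • (((L : ℂ))⁻¹ • P * (((L : ℂ))⁻¹ • P)ᴴ) = c • (P * Pᴴ)
    rw [conjTranspose_smul, hLs, smul_mul_assoc, mul_smul_comm, smul_smul, smul_smul, hcJ]
  have hD'D : (J : ℂ) • (Dᴴ * D) = c • (Pᴴ * P) := by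
    show (J : ℂ) • ((((L : ℂ))⁻¹ • P)ᴴ * ((L : ℂ))⁻¹ • P) = c • (Pᴴ * P)
    rw [conjTranspose_smul, hLs, smul_mul_assoc, mul_smul_comm, smul_smul, smul_smul, hcJ]
  -- block floors: on the block `(2k, S^z = 0)`, `A - c Q ≥ minEnergyOn (H - c Q) - μ · 2k`
  have hfloor : ∀ Q : Matrix ι ι ℂ, Q.IsHermitian → ∀ {k : ℕ}, ∀ v : ι → ℂ,
      (∀ s, ¬ (s.card = 2 * k ∧ F s) → v s = 0) →
      ((H - c • Q).minEnergyOn (szSector (2 * k) 0) - μ * (2 * k : ℕ)) * (star v ⬝ᵥ v).re ≤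
        (star v ⬝ᵥ (A - c • Q) *ᵥ v).re := by
    intro Q hQ k v hv
    have hsec : IsInSector k k v := fun s hs => hv s fun h => hs ((block_iff k s).1 h)
    have hN : IsNParticle (2 * k) v := by simpa [two_mul] using hsec.isNParticle
    have hherm : (H - c • Q).IsHermitian := hHherm.sub (hQ.smul (Complex.conj_ofReal _))
    have hfl : (H - c • Q).minEnergyOn (szSector (2 * k) 0) * (star v ⬝ᵥ v).re ≤
        (star v ⬝ᵥ (H - c • Q) *ᵥ v).re :=
      mul_norm_le_of_unit_bound (H - c • Q)
        (fun w hw hw1 => minEnergyOn_le_rayleigh_of_mem hherm _ hw hw1) hsec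
    have hAv : (A - c • Q) *ᵥ v = (H - c • Q) *ᵥ v - ((μ : ℂ) * ((2 * k : ℕ) : ℂ)) • v := by
      have hA : A = H - (μ : ℂ) • totalNumber := rfl
      rw [hA, sub_mulVec, sub_mulVec, sub_mulVec, smul_mulVec,
        totalNumber_mulVec_of_isNParticle hN, smul_smul]; abel
    rw [hAv, dotProduct_sub, dotProduct_smul, Complex.sub_re, smul_eq_mul, ← Complex.ofReal_natCast,
      ← Complex.ofReal_mul, Complex.re_ofReal_mul, sub_mul]
    linarith
  have hPP : (P * Pᴴ).IsHermitian := isHermitian_mul_conjTranspose_self P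
  have hP'P : (Pᴴ * P).IsHermitian := isHermitian_conjTranspose_mul_self P
  have hx₁ : ∀ v : ι → ℂ, (∀ s, ¬ P₁ s → v s = 0) →
      ((H - c • (P * Pᴴ)).minEnergyOn (szSector N 0) - μ * N) * (star v ⬝ᵥ v).re ≤
        (star v ⬝ᵥ (A - (J : ℂ) • (D * Dᴴ)) *ᵥ v).re := fun v hv => by
    rw [hDD, hNn]; exact hfloor _ hPP v (by simpa [hP₁, hF, hNn] using hv)
  have hx₂ : ∀ v : ι → ℂ, (∀ s, ¬ P₂ s → v s = 0) →
      ((H - c • (P * Pᴴ)).minEnergyOn (szSector (N - 2) 0) - μ * ((N - 2 : ℕ) : ℝ)) *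
          (star v ⬝ᵥ v).re ≤ (star v ⬝ᵥ (A - (J : ℂ) • (D * Dᴴ)) *ᵥ v).re := fun v hv => by
    rw [hDD, hN2]; exact hfloor _ hPP v (by simpa [hP₂, hF, hN2] using hv)
  have hy₁ : ∀ v : ι → ℂ, (∀ s, ¬ P₁ s → v s = 0) →
      ((H - c • (Pᴴ * P)).minEnergyOn (szSector N 0) - μ * N) * (star v ⬝ᵥ v).re ≤
        (star v ⬝ᵥ (A - (J : ℂ) • (Dᴴ * D)) *ᵥ v).re := fun v hv => by
    rw [hD'D, hNn]; exact hfloor _ hP'P v (by simpa [hP₁, hF, hNn] using hv)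
  have hy₂ : ∀ v : ι → ℂ, (∀ s, ¬ P₂ s → v s = 0) →
      ((H - c • (Pᴴ * P)).minEnergyOn (szSector (N - 2) 0) - μ * ((N - 2 : ℕ) : ℝ)) *
          (star v ⬝ᵥ v).re ≤ (star v ⬝ᵥ (A - (J : ℂ) • (Dᴴ * D)) *ᵥ v).re := fun v hv => by
    rw [hD'D, hN2]; exact hfloor _ hP'P v (by simpa [hP₂, hF, hN2] using hv)
  -- a unit ground state of the block `(N_L, S^z = 0)`: `A φ = a φ`
  have hcard : n ≤ Fintype.card (FermionTorus 2 L) := by rwa [card_fermionTorus]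
  obtain ⟨⟨φ₀, hφ₀mem, hφ₀ne, hHφ₀⟩, -⟩ := szSector_groundState (fermionTorusGraph 2 L) 1 U hcard
  obtain ⟨cφ, -, hφ1⟩ := exists_smul_unit hφ₀ne
  set φ : ι → ℂ := cφ • φ₀ with hφ
  have hφmem : φ ∈ szSector N 0 := (szSector (2 * n) 0).smul_mem cφ hφ₀mem
  have hφsec : IsInSector n n φ := (mem_szSector_two_mul_zero_iff n φ).1 hφmem
  have hφP : ∀ s, ¬ P₁ s → φ s = 0 := fun s hs =>
    hφsec s fun h => hs (by simpa [hP₁, hF, hNn] using (block_iff n s).2 h)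
  have hφN : IsNParticle N φ := (mem_szSector_iff N 0 φ).1 hφmem |>.1
  have hHφ : H *ᵥ φ = (e₁ : ℂ) • φ := by
    rw [hφ, mulVec_smul, show H *ᵥ φ₀ = (e₁ : ℂ) • φ₀ from hHφ₀, smul_comm]
  have hAφ : A *ᵥ φ = (a : ℂ) • φ := by
    have hA : A = H - (μ : ℂ) • totalNumber := rfl
    rw [hA, sub_mulVec, smul_mulVec, totalNumber_mulVec_of_isNParticle hφN, smul_smul, hHφ,
      ← sub_smul, ha]
    push_cast; rfl
  have key := minEnergyOn_sub_le_max_blockGain A D hAherm P₁ P₂ h12 good hgood hgood₁ S hS a φ hφP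
    hφ1 hAφ hJ _ _ _ _ hx₁ hx₂ hy₁ hy₂
  refine key.trans (le_of_eq ?_)
  show _ = (e₁ - (H - c • (P * Pᴴ)).minEnergyOn (szSector N 0) +
      (e₁ - (H - c • (Pᴴ * P)).minEnergyOn (szSector N 0))) ⊔
    (e₂ - (H - c • (P * Pᴴ)).minEnergyOn (szSector (N - 2) 0) +
      (e₂ - (H - c • (Pᴴ * P)).minEnergyOn (szSector (N - 2) 0)))
  congr 1
  · rw [ha]
    ring
  · rw [ha₂]
    ring

/-- **The Josephson gain is at most the two-sector single-layer deformation gain**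
(`JosephsonGain ⇒ TwoSectorCusp` of the line skeleton `Sketch`, crux `JmCusp`, both unfolded verbatim):
the uniform linear gain `a J L² ≤ E_L(0) - E_L(J)` of the window double forces the same lower bound
on the better window sector's `G(N') (Δ_d Δ_dᴴ) + G(N') (Δ_dᴴ Δ_d)` at coupling `J / L²` — nothing is
lost by de-doubling (Kronecker AM–GM ceiling, block decomposition of the window, `E(0) ≤ 2a`).
Bru–de Siqueira Pedra, Rev. Math. Phys. 22 (2010) 233; Koma–Tasaki, J. Stat. Phys. 76 (1994) 745.
[folklore] -/
theorem twoSectorCusp_of_josephsonGain (U δ a J₀ : ℝ) (hδ : δ ∈ Set.Ioo (0:ℝ) (1 / 2)) :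
    (∀ J ∈ Set.Ioc (0:ℝ) J₀, ∃ L₀ : ℕ, ∀ (L : ℕ) [NeZero L], Even L → L₀ ≤ L → (let ι : Type := Finset (Literature.MathematicalPhysics.QuantumLattice.Orb (Literature.MathematicalPhysics.QuantumLattice.FermionTorus 2 L)); let N : ℕ := 2 * ⌊(1 - δ) * (L : ℝ) ^ 2 / 2⌋₊; let H : Matrix ι ι ℂ := Literature.MathematicalPhysics.QuantumLattice.hubbardTorus 2 L 1 U; let μ : ℝ := (H.minEnergyOn (Literature.MathematicalPhysics.QuantumLattice.szSector N 0) - H.minEnergyOn (Literature.MathematicalPhysics.QuantumLattice.szSector (N - 2) 0)) / 2; let A : Matrix ι ι ℂ := Literature.MathematicalPhysics.QuantumLattice.hubbardTorusWith 2 L 1 U μ; let D : Matrix ι ι ℂ := ((L : ℂ))⁻¹ • Literature.MathematicalPhysics.QuantumLattice.pairField Literature.MathematicalPhysics.QuantumLattice.dWaveFormFactor L; let Hd : ℝ → Matrix (ι × ι) (ι × ι) ℂ := fun J => Matrix.kroneckerMap (fun a b : ℂ => a * b) A 1 + Matrix.kroneckerMap (fun a b : ℂ => a * b) 1 (Matrix.transpose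 A) - (J : ℂ) • (Matrix.kroneckerMap (fun a b : ℂ => a * b) D (Matrix.transpose (Matrix.conjTranspose D)) + Matrix.kroneckerMap (fun a b : ℂ => a * b) (Matrix.conjTranspose D) (Matrix.transpose D)); let good : ι × ι → Prop := fun p => ((p.1.card = N ∧ p.2.card = N) ∨ (p.1.card = N - 2 ∧ p.2.card = N - 2)) ∧ (p.1.filter (fun o => (ofLex o).2 = 0)).card = (p.1.filter (fun o => (ofLex o).2 = 1)).card ∧ (p.2.filter (fun o => (ofLex o).2 = 0)).card = (p.2.filter (fun o => (ofLex o).2 = 1)).card; let S : Submodule ℂ (ι × ι → ℂ) := ⨅ (p : ι × ι) (_ : ¬ good p), LinearMap.ker (LinearMap.proj (R := ℂ) (φ := fun _ : ι × ι => ℂ) p); let E : ℝ → ℝ := fun J => (Hd J).minEnergyOn S; a * J * (L : ℝ) ^ 2 ≤ E 0 - E J)) →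
    ∀ J ∈ Set.Ioc (0:ℝ) J₀, ∃ L₀ : ℕ, ∀ (L : ℕ) [NeZero L], Even L → L₀ ≤ L → (let ι : Type := Finset (Literature.MathematicalPhysics.QuantumLattice.Orb (Literature.MathematicalPhysics.QuantumLattice.FermionTorus 2 L)); let N : ℕ := 2 * ⌊(1 - δ) * (L : ℝ) ^ 2 / 2⌋₊; let H : Matrix ι ι ℂ := Literature.MathematicalPhysics.QuantumLattice.hubbardTorus 2 L 1 U; let P : Matrix ι ι ℂ := Literature.MathematicalPhysics.QuantumLattice.pairField Literature.MathematicalPhysics.QuantumLattice.dWaveFormFactor L; let c : ℂ := ((J / (L : ℝ) ^ 2 : ℝ) : ℂ); let G : ℕ → Matrix ι ι ℂ → ℝ := fun n Q => H.minEnergyOn (Literature.MathematicalPhysics.QuantumLattice.szSector n 0) - (H - c • Q).minEnergyOn (Literature.MathematicalPhysics.QuantumLattice.szSector n 0); a * J * (L : ℝ) ^ 2 ≤ (G N (P * Pᴴ) + G N (Pᴴ * P)) ⊔ (G (N - 2) (P * Pᴴ) + G (N - 2) (Pᴴ * P))) := by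
  intro hgain J hJ
  obtain ⟨L₀, hL₀⟩ := hgain J hJ
  refine ⟨L₀, fun L _ hE hL => ?_⟩
  exact le_trans (hL₀ L hE hL) (josephsonGain_le_twoSectorGain L U δ J hE hδ hJ.1.le)

/-- **Stub `stub_amgm_converse`** of the line skeleton `Sketch` (crux `JmCusp`,
stmt-HubbardSuperconductivity-2228), registered signature verbatim: `twoSectorCusp_of_josephsonGain`.
Bru–de Siqueira Pedra, Rev. Math. Phys. 22 (2010) 233; Koma–Tasaki, J. Stat. Phys. 76 (1994) 745.
[folklore] -/
theorem stub_amgm_converse (U δ a J₀ : ℝ) (hδ : δ ∈ Set.Ioo (0:ℝ) (1 / 2)) :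
    (∀ J ∈ Set.Ioc (0:ℝ) J₀, ∃ L₀ : ℕ, ∀ (L : ℕ) [NeZero L], Even L → L₀ ≤ L → (let ι : Type := Finset (Literature.MathematicalPhysics.QuantumLattice.Orb (Literature.MathematicalPhysics.QuantumLattice.FermionTorus 2 L)); let N : ℕ := 2 * ⌊(1 - δ) * (L : ℝ) ^ 2 / 2⌋₊; let H : Matrix ι ι ℂ := Literature.MathematicalPhysics.QuantumLattice.hubbardTorus 2 L 1 U; let μ : ℝ := (H.minEnergyOn (Literature.MathematicalPhysics.QuantumLattice.szSector N 0) - H.minEnergyOn (Literature.MathematicalPhysics.QuantumLattice.szSector (N - 2) 0)) / 2; let A : Matrix ι ι ℂ := Literature.MathematicalPhysics.QuantumLattice.hubbardTorusWith 2 L 1 U μ; let D : Matrix ι ι ℂ := ((L : ℂ))⁻¹ • Literature.MathematicalPhysics.QuantumLattice.pairField Literature.MathematicalPhysics.QuantumLattice.dWaveFormFactor L; let Hd : ℝ → Matrix (ι × ι) (ι × ι) ℂ := fun J => Matrix.kroneckerMap (fun a b : ℂ => a * b) A 1 + Matrix.kroneckerMap (fun a b : ℂ => a * b) 1 (Matrix.transpose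 A) - (J : ℂ) • (Matrix.kroneckerMap (fun a b : ℂ => a * b) D (Matrix.transpose (Matrix.conjTranspose D)) + Matrix.kroneckerMap (fun a b : ℂ => a * b) (Matrix.conjTranspose D) (Matrix.transpose D)); let good : ι × ι → Prop := fun p => ((p.1.card = N ∧ p.2.card = N) ∨ (p.1.card = N - 2 ∧ p.2.card = N - 2)) ∧ (p.1.filter (fun o => (ofLex o).2 = 0)).card = (p.1.filter (fun o => (ofLex o).2 = 1)).card ∧ (p.2.filter (fun o => (ofLex o).2 = 0)).card = (p.2.filter (fun o => (ofLex o).2 = 1)).card; let S : Submodule ℂ (ι × ι → ℂ) := ⨅ (p : ι × ι) (_ : ¬ good p), LinearMap.ker (LinearMap.proj (R := ℂ) (φ := fun _ : ι × ι => ℂ) p); let E : ℝ → ℝ := fun J => (Hd J).minEnergyOn S; a * J * (L : ℝ) ^ 2 ≤ E 0 - E J)) →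
    ∀ J ∈ Set.Ioc (0:ℝ) J₀, ∃ L₀ : ℕ, ∀ (L : ℕ) [NeZero L], Even L → L₀ ≤ L → (let ι : Type := Finset (Literature.MathematicalPhysics.QuantumLattice.Orb (Literature.MathematicalPhysics.QuantumLattice.FermionTorus 2 L)); let N : ℕ := 2 * ⌊(1 - δ) * (L : ℝ) ^ 2 / 2⌋₊; let H : Matrix ι ι ℂ := Literature.MathematicalPhysics.QuantumLattice.hubbardTorus 2 L 1 U; let P : Matrix ι ι ℂ := Literature.MathematicalPhysics.QuantumLattice.pairField Literature.MathematicalPhysics.QuantumLattice.dWaveFormFactor L; let c : ℂ := ((J / (L : ℝ) ^ 2 : ℝ) : ℂ); let G : ℕ → Matrix ι ι ℂ → ℝ := fun n Q => H.minEnergyOn (Literature.MathematicalPhysics.QuantumLattice.szSector n 0) - (H - c • Q).minEnergyOn (Literature.MathematicalPhysics.QuantumLattice.szSector n 0); a * J * (L : ℝ) ^ 2 ≤ (G N (P * Pᴴ) + G N (Pᴴ * P)) ⊔ (G (N - 2) (P * Pᴴ) + G (N - 2) (Pᴴ * P))) :=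
  twoSectorCusp_of_josephsonGain U δ a J₀ hδ

end Torus
end Summit.HubbardSuperconductivity.HubbardSuperconductivity.Theorems.JosephsonMirror
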